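import Literature.NumberTheory.GaloisRepresentations.LubinTateComparisonPoints
import HarnessLib

/-!
# Points of Lubin–Tate groups: the evaluation `h(x)` IS the convergent series `Σ_m h_m x^m`

Topic `NumberTheory/GaloisRepresentations`; namespace `Literature.NumberTheory.GaloisRepresentations`
(sub-namespace `LubinTate` for the abstract lemma, as in `LubinTatePoints.lean`). Cell `bsd-print-cf2`
(HOME `run/shared/lean/pub/bsd-print-cf2/`), seat `bsd-line-cf2-p1-w7` g7, assignment of planner g20
(2026-08-29T11:51:38Z): **GAP-5** of cf2c-w4 g5's `Cruxes/TwoVariableMainConjAtSplitTwoQuad/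
ASSEMBLY-GUIDE-measure-side-w4g5.md` §1 («the one-liner `coe_evalPt₁` + Mathlib `PowerSeries.hasSum_aeval`
+ `HasSum.map` along `CBall → ℂ`: the tsum form for the measure criterion»).

The tree evaluates a constant-term-free series `h ∈ A⟦X⟧` at a point `x` of a closed nil ideal `M` of a
complete linearly topologised `A`-algebra `S` as `LubinTate.evalPt₁ M h hh x ∈ M` (`LubinTatePoints.lean`;
= Mathlib's `PowerSeries.aeval`, `coe_evalPt₁`), and on the open unit ball `𝔪_ℂ ⊂ 𝒪_{ℂ_F}` of
`ℂ_F = \widehat{F̄}` with coefficients in the discrete copy `UnrCoeff F` of `𝒪̂_{F^nr}`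
(`LubinTateComparisonPoints.lean`: `CBall F`, `maxNilIdealC F`, `coeffToCBall`). The measure criterion of
the two-variable main-conjecture assembly (`PadicComplex.forall_invAmice₁_μ_eq_zero_of_nthRoots`,
`PAdicOneVariableTraceCriterionComplex.lean`) speaks instead the CONVERGENT SERIES `Σ' m, [X^m]h · x^m` in
the complete field. This file identifies the two:

* `LubinTate.hasSum_coeff_smul_pow_evalPt₁` — abstract: `Σ_m h_m • x^m` converges to `evalPt₁ M h hh x` in `S`;
* `hasSum_coeffToCBall_mul_pow_evalPt₁` — in `ℂ_F`: `Σ_m ι(h_m) · x^m` converges to `h(x)`, `ι = coeffToCBall`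
  (`𝒪̂_{F^nr} → 𝒪_{ℂ_F} ⊂ ℂ_F`);
* `coe_evalPt₁_eq_tsum` — `h(x) = Σ' m, ι(h_m) · x^m` in `ℂ_F`; `summable_coeffToCBall_mul_pow`.

All proved (Mathlib `PowerSeries.hasSum_aeval`, `HasSum.map` along the continuous inclusion
`𝒪_{ℂ_F} ⊂ ℂ_F`); no definition, no named fact, no `sorry`. HONEST FRAMING: analytic plumbing for brick (d)
of the (Q)-socket; nothing about elliptic curves; BSD is not advanced by this file.

## References
* [CasselsFrohlichANT1967] J.-P. Serre, *Local class field theory* (Cassels–Fröhlich Ch. VI), §3.2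
  (power series converge on the maximal ideal of a complete local ring).
* [SerreLocalFields1979] J.-P. Serre, *Local Fields*, Ch. II §5 (`𝒪̂_{F^nr} ⊂ 𝒪_{ℂ_F}`).
-/

noncomputable section

open MvPowerSeries

namespace Literature.NumberTheory.GaloisRepresentations

namespace LubinTate

/-! ### Abstract: `evalPt₁` as the sum of the series -/

section Points

variable {A : Type*} [CommRing A] [UniformSpace A] [DiscreteUniformity A]
variable {S : Type*} [CommRing S] [UniformSpace S] [IsUniformAddGroup S] [IsTopologicalRing S]
  [IsLinearTopology S S] [T2Space S] [CompleteSpace S] [Algebra A S] [ContinuousSMul A S]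
variable (M : NilIdeal S)

/-- **`h(x) = Σ_m h_m x^m`**: the series of monomials `[X^m]h • x^m` converges in `S` to the evaluation
`evalPt₁ M h hh x` of a constant-term-free `h ∈ A⟦X⟧` at a point `x ∈ M` (Mathlib's
`PowerSeries.hasSum_aeval` read through `coe_evalPt₁`). [cite: CasselsFrohlichANT1967, Ch. VI §3.2] -/
theorem hasSum_coeff_smul_pow_evalPt₁ (h : PowerSeries A) (hh : PowerSeries.constantCoeff h = 0)
    (x : M.toIdeal) :
    HasSum (fun m : ℕ => PowerSeries.coeff m h • ((x : S) ^ m)) ((evalPt₁ M h hh x : M.toIdeal) : S) := by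
  rw [coe_evalPt₁]
  exact PowerSeries.hasSum_aeval (M.isTopologicallyNilpotent _ x.2) h

/-- The tsum spelling: `evalPt₁ M h hh x = Σ' m, [X^m]h • x^m` in `S`. [cite: CasselsFrohlichANT1967, Ch. VI §3.2] -/
theorem coe_evalPt₁_eq_tsum_smul (h : PowerSeries A) (hh : PowerSeries.constantCoeff h = 0) (x : M.toIdeal) :
    ((evalPt₁ M h hh x : M.toIdeal) : S) = ∑' m : ℕ, PowerSeries.coeff m h • ((x : S) ^ m) :=
  (hasSum_coeff_smul_pow_evalPt₁ M h hh x).tsum_eq.symm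

end Points

end LubinTate

/-! ### On `𝔪_ℂ ⊂ 𝒪_{ℂ_F}`: the expansion in the complete field `ℂ_F` -/

section CPoints

open ValuativeRel IsLocalRing Field IsNonarchimedeanLocalField LubinTate
open Literature.NumberTheory.PAdicHodge

variable {F : Type} [Field F] [ValuativeRel F] [TopologicalSpace F] [IsNonarchimedeanLocalField F]

/-- Coercion bookkeeping: a scalar multiple `c • y` in `𝒪_{ℂ_F}` (`c ∈ 𝒪̂_{F^nr}`, discrete copy) read in
`ℂ_F` is `ι(c) · y` with `ι = coeffToCBall`. [cite: SerreLocalFields1979, Ch. II §5] -/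
theorem coe_unrCoeff_smul (c : UnrCoeff F) (y : CBall F) :
    (((c • y : CBall F)) : CompletedAlgClosure F) =
      ((coeffToCBall F c : CBall F) : CompletedAlgClosure F) * (y : CompletedAlgClosure F) := by
  rw [Algebra.smul_def, Subring.coe_mul]
  rfl

/-- **`h(x) = Σ_m ι(h_m) x^m` in `ℂ_F`**: for a constant-term-free `h ∈ 𝒪̂_{F^nr}⟦X⟧` (discrete copy
`UnrCoeff F`) and a point `x ∈ 𝔪_ℂ`, the series `Σ_m ι([X^m]h) · x^m` converges in `ℂ_F` to the point
`evalPt₁ (maxNilIdealC F) h hh x` (pushed along the continuous inclusion `𝒪_{ℂ_F} ⊂ ℂ_F`).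
[cite: CasselsFrohlichANT1967, Ch. VI §3.2] [cite: SerreLocalFields1979, Ch. II §5] -/
theorem hasSum_coeffToCBall_mul_pow_evalPt₁ (h : PowerSeries (UnrCoeff F))
    (hh : PowerSeries.constantCoeff h = 0) (x : (maxNilIdealC F).toIdeal) :
    HasSum (fun m : ℕ => ((coeffToCBall F (PowerSeries.coeff m h) : CBall F) : CompletedAlgClosure F) *
        (((x : CBall F)) : CompletedAlgClosure F) ^ m)
      ((((evalPt₁ (maxNilIdealC F) h hh x : (maxNilIdealC F).toIdeal) : CBall F)) : CompletedAlgClosure F) := by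
  have h1 := (hasSum_coeff_smul_pow_evalPt₁ (maxNilIdealC F) h hh x).map (CBall F).subtype
    continuous_subtype_val
  refine HasSum.congr_fun h1 fun m => ?_
  simp only [Function.comp_apply, Subring.coe_subtype, coe_unrCoeff_smul, Subring.coe_pow]

/-- The series `Σ_m ι(h_m) x^m` is summable in `ℂ_F`. [cite: CasselsFrohlichANT1967, Ch. VI §3.2] -/
theorem summable_coeffToCBall_mul_pow (h : PowerSeries (UnrCoeff F)) (hh : PowerSeries.constantCoeff h = 0)
    (x : (maxNilIdealC F).toIdeal) :
    Summable (fun m : ℕ => ((coeffToCBall F (PowerSeries.coeff m h) : CBall F) : CompletedAlgClosure F) *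
        (((x : CBall F)) : CompletedAlgClosure F) ^ m) :=
  (hasSum_coeffToCBall_mul_pow_evalPt₁ h hh x).summable

/-- **The tsum form used by the measure criterion**: `h(x) = Σ' m, ι([X^m]h) · x^m` in `ℂ_F`.
[cite: CasselsFrohlichANT1967, Ch. VI §3.2] [cite: SerreLocalFields1979, Ch. II §5] -/
theorem coe_evalPt₁_eq_tsum (h : PowerSeries (UnrCoeff F)) (hh : PowerSeries.constantCoeff h = 0)
    (x : (maxNilIdealC F).toIdeal) :
    ((((evalPt₁ (maxNilIdealC F) h hh x : (maxNilIdealC F).toIdeal) : CBall F)) : CompletedAlgClosure F) =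
      ∑' m : ℕ, ((coeffToCBall F (PowerSeries.coeff m h) : CBall F) : CompletedAlgClosure F) *
        (((x : CBall F)) : CompletedAlgClosure F) ^ m :=
  (hasSum_coeffToCBall_mul_pow_evalPt₁ h hh x).tsum_eq.symm

end CPoints

end Literature.NumberTheory.GaloisRepresentations

end
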